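import Summits.Ventures.KdS.RouteW

/-!
# Venture KdS — ROUTE W, non-resonant variant of `EulerRL`

HONEST FRAMING (venture `Summits/Ventures/KdS`, cell `pub-kds`; MONDAY-REBALANCE item 2 decision
object, NOT a result about Kerr–de Sitter): this file repairs a STATEMENT DEFECT of the hypothesis
`RouteW.EulerRL` of `Summits/Ventures/KdS/RouteW.lean` found by LIT-1 g6 (exact CAS, pub-kds kit
j170060, cell memo `lit/LIT1-KB-ARCHITECTURE.md` §1) and re-proves the route-W composition with the
repaired hypothesis. Nothing here discharges H3; `EulerRLNonRes` is a hypothesis like `EulerRL`.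

THE DEFECT. `EulerRL` asks the one-sided Euler / Riemann–Liouville transform
`u = ∂_z^k ∫₀¹ (z−1)^{k+η−1}(1−t)^{k+η−2} v(1+(z−1)t) dt` (essentially the Riemann–Liouville
derivative `D^{1−η}_{1+} v`) to be injective on ALL Euler-gauge mode data `v = (w−1)^ρ·h`,
`Re ρ > −1`. It is not: `D^{1−η}` kills `(w−1)^{η−1−i}`, `1 ≤ i ≤ k`, and an honest mode datum lies
in that kernel iff the TARGET exponent `ρ_T := ρ + η − 1` is a negative integer (resonance; explicit
witness: `δ = 1+α`, `q = −αγ·a_H`, `v = (w−1)^{−α}`, whose `k = 1` transform is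
`∂_z B(α,1−α) ≡ 0`). Whether `EulerRL` is nevertheless true on the resonant set is a case-by-case
Frobenius question the route does not need.

THE REPAIR. `EulerRLNonRes` = `EulerRL` with one more hypothesis, NON-RESONANCE
`∀ n : ℕ, ρ + η − 1 ≠ −(n+1)`. In the Kerr–de Sitter assembly (`radial_vanishing_of_routeW_lt_one`)
the transform is applied with `η = α = 1 + s + 2η₀` and `ρ = 2η₁ − s`, so
`ρ + η − 1 = 2(η₀ + η₁) = −p₃` where `p₃ := −2(η₁ + η₀) = m₁ + m₃` is the third pair sum of CTdC's
Proposition 3.8 (`rho_add_eta_sub_one_eq`); and H3's binder `PairCondition p₃` ("`Re(p₃−1) < 0` if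
`Im p₃ = 0`"), IGNORED by `prop38_of_routeW`, forbids `p₃ ∈ ℤ_{≥1}`, i.e. IS the non-resonance
(`nonres_of_pairCondition`). So CTdC's pair condition on `m₁ + m₃` is exactly the non-resonance of
the hidden-symmetry transform — not idle for route W. PROVED here:
`prop38_of_routeW_nonres : Transfer → EulerRLNonRes → GaugeGlue → SwappedEnergyVanishing → SpinFlip →`
`  CasalsTeixeiraDaCosta2022_partialModeStabilityProp38` (kernel-checked composition, H3 by name),
and `eulerRLNonRes_of_eulerRL : EulerRL → EulerRLNonRes` (the repaired hypothesis is weaker).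
With `transfer_holds`, `gaugeGlue_holds`, `swappedEnergyVanishing_holds` LANDED, route W for the
cell's spins `s = −2, 0` now rests on `EulerRLNonRes` alone (`SpinFlip` enters only for `s ≥ 1`).

References: Casals–Teixeira da Costa, Commun. Math. Phys. 394 (2022) 797–832
[CasalsTeixeiradacosta2022] Prop. 3.8, (3.10), (3.15); K. Takemura, J. Math. Soc. Japan 69 (2017)
849–891 [Takemura2017] Prop. 1.2.
-/

noncomputable section

open Set Complex

namespace Summit.Ventures.KdS

namespace RouteW

open Literature.Analysis.ODE Literature.Analysis.ODE.GeneralHeun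
open Literature.Geometry.Lorentzian Literature.Geometry.Lorentzian.KerrDeSitter

/-! ### The repaired hypothesis -/

/-- **K_B, non-resonant variant — the one-sided Euler / Riemann–Liouville transform for Heun's
equation off resonance.** Exactly `RouteW.EulerRL` with the additional hypothesis
`∀ n : ℕ, ρ + η − 1 ≠ −(n+1)` (the target exponent `ρ_T = ρ + η − 1` at `z = 1` is not a negative
integer): for a Heun equation on `(1,z₂)` (`a_H = z₂ > 1`, Fuchs relation), a source exponent
`η ∈ {α, β}`, and an Euler-gauge mode datum `v` with branch exponent `ρ = 1 − δ`, `Re ρ > −1`,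
`ρ + η − 1 ∉ ℤ_{≤−1}`, there is Euler-gauge mode data `u` for Takemura's image parameters with
branch exponent `ρ + η − 1` at `1` and the analytic branch at `z₂`, with `u ≡ 0 ⇒ v ≡ 0`. Intended
proof (LIT-1 g6, `lit/LIT1-KB-ARCHITECTURE.md` §3): `u = ∂_z^k Φ_{θ−k}[v]`, `θ = 2 − η`,
`Re θ < k+1`; the ODE by analytic continuation in the kernel exponent from the `k = 0` Euler theorem
(`GeneralHeun.euler_tau_identity`); injectivity by the Riemann–Liouville semigroup and independence
of the powers `(w−1)^{−ρ_T−i}`, `1 ≤ i ≤ k`, from smooth functions — which is where non-resonance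
enters. -/
def EulerRLNonRes : Prop :=
  ∀ (z₂ : ℝ) (α β γ δ ε q η ρ : ℂ) (v : ℝ → ℂ), 1 < z₂ → γ + δ + ε = α + β + 1 →
    (η - α) * (η - β) = 0 → ρ = 1 - δ → -1 < ρ.re → (∀ n : ℕ, ρ + η - 1 ≠ -((n : ℂ) + 1)) →
    HeunModeData z₂ α β γ δ ε q ρ v →
      ∃ u : ℝ → ℂ,
        HeunModeData z₂ (eulerSrcα η) (eulerSrcβ α β η) (eulerSrc γ η) (eulerSrc δ η)
          (eulerSrc ε η) (eulerSrcQ (z₂ : ℂ) γ δ ε q η) (ρ + η - 1) u ∧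
        ((∀ z ∈ Ioo 1 z₂, u z = 0) → ∀ w ∈ Ioo 1 z₂, v w = 0)

/-- The repaired hypothesis is WEAKER than the original one: `EulerRL → EulerRLNonRes`. -/
theorem eulerRLNonRes_of_eulerRL (h : EulerRL) : EulerRLNonRes :=
  fun z₂ α β γ δ ε q η ρ v hz₂ hF hroot hρ hre _ hv => h z₂ α β γ δ ε q η ρ v hz₂ hF hroot hρ hre hv

/-! ### The Kerr–de Sitter non-resonance is CTdC's pair condition on `m₁ + m₃` -/

/-- **The target exponent of the hidden-symmetry transform.** With the Euler exponent
`η = α = 1 + s + 2η₀` (`eulerGaugeα_eta`) and the event-horizon branch `ρ = 2η₁ − s`: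
`ρ + η − 1 = 2(η₀ + η₁)` (`= −(m₁ + m₃)`, the negative of Proposition 3.8's third pair sum). -/
theorem rho_add_eta_sub_one_eq (s η₀ η₁ : ℂ) :
    2 * η₁ - s + eulerGaugeα (sqcdM₂ η₀ η₁) (sqcdM₃ s η₀ η₁) - 1 = 2 * (η₀ + η₁) := by
  rw [eulerGaugeα_eta]
  ring

/-- **Non-resonance from the pair condition.** If `p₃ = −2(η₁ + η₀)` satisfies Proposition 3.8's
pair condition ("`Re(p₃ − 1) < 0` if `Im p₃ = 0`"), then `2(η₀ + η₁) = −p₃` is not a negative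
integer. -/
theorem nonres_of_pairCondition {η₀ η₁ : ℂ} (hp : PairCondition (-2 * (η₁ + η₀))) (n : ℕ) :
    2 * (η₀ + η₁) ≠ -((n : ℂ) + 1) := by
  intro h
  have hp' : -2 * (η₁ + η₀) = (n : ℂ) + 1 := by linear_combination -h
  have him : (-2 * (η₁ + η₀)).im = 0 := by
    rw [hp']; simp
  have hre := hp him
  rw [hp'] at hre
  simp at hre
  have : (0 : ℝ) ≤ (n : ℝ) := n.cast_nonneg
  linarith

/-! ### The assembly with the repaired hypothesis -/

/-- **Route W for spins `s < 1`, non-resonant variant** (covers the cell's `s = −2` and `s = 0`):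
`Transfer`, `EulerRLNonRes`, `GaugeGlue` and `SwappedEnergyVanishing` imply that every
generic-boundary radial mode with `Im ω > 0`, `Im(λ̄ω̄) ≤ 0`, `|ω| ∉ |m|(0,Ω_SR)` AND Proposition 3.8's
pair condition for `p₃ = −2(η₁ + η₀)` vanishes. PROVED (the composition is kernel-checked); the pair
condition discharges the non-resonance hypothesis of `EulerRLNonRes` via `rho_add_eta_sub_one_eq`
and `nonres_of_pairCondition`. -/
theorem radial_vanishing_of_routeW_nonres_lt_one (kA : Transfer) (kB : EulerRLNonRes)
    (kG : GaugeGlue) (k2 : SwappedEnergyVanishing) {M a Λ s : ℝ} {ω : ℂ} {m : ℝ} {lam : ℂ}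
    {R : ℝ → ℂ} (hsub : IsSubextremal M a Λ) (ha : 0 ≤ a) (hs : s < 1) (hω : 0 < ω.im)
    (hlam : (lambdaBar a Λ s ω m lam * (starRingEnd ℂ) ω).im ≤ 0)
    (hSR : ¬(0 < ‖ω‖ ∧ ‖ω‖ < |m| * superradiantUpper M a Λ))
    (hp₃ : PairCondition (-2 * (etaEvent M a Λ ω m + etaCauchy M a Λ ω m)))
    (hR : IsRadialTeukolskySolution M a Λ s ω m lam R) (hin : IsIngoingAtEventHorizon M a Λ s ω m R)
    (hout : IsOutgoingAtCosmoHorizon M a Λ ω m R) :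
    ∀ r ∈ Ioo (rPlus M a Λ) (rCosmo M a Λ), R r = 0 := by
  obtain ⟨hz₂, v, hv, hvR⟩ := kA M a Λ s ω m lam R hsub hR hin hout
  -- abbreviations
  set η₀ := etaCauchy M a Λ ω m with hη₀
  set η₁ := etaEvent M a Λ ω m with hη₁
  set η₂ := etaCosmo M a Λ ω m with hη₂
  set z₂ := zTwo M a Λ with hz₂def
  -- the Euler step: source exponent η = α = 1 + s + 2η₀
  have hF := eulerGauge_fuchs (mass₁ M a Λ s ω m) (mass₂ M a Λ ω m) (mass₃ M a Λ s ω m)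
    (mass₄ M a Λ ω m)
  have hroot := euler_exponent_root (mass₂ M a Λ ω m) (mass₃ M a Λ s ω m) (mass₄ M a Λ ω m)
  have hρ : 2 * etaEvent M a Λ ω m - (s : ℂ) =
      1 - eulerGaugeδ (mass₁ M a Λ s ω m) (mass₂ M a Λ ω m) := by
    unfold mass₁ mass₂
    rw [eulerGaugeδ_eta]
    ring
  have hκ₁ := surfaceGravity_rPlus_pos hsub
  have hre : -1 < (2 * etaEvent M a Λ ω m - (s : ℂ)).re := by
    have h1 : (2 * etaEvent M a Λ ω m - (s : ℂ)).re = 2 * (etaEvent M a Λ ω m).re - s := by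
      simp [Complex.mul_re]
    rw [h1, etaEvent_re]
    have h2 : 0 < ω.im / (2 * surfaceGravity M a Λ (rPlus M a Λ)) :=
      div_pos hω (mul_pos two_pos hκ₁)
    linarith
  -- NON-RESONANCE: ρ + η − 1 = 2(η₀ + η₁) = −p₃, and `PairCondition p₃` forbids p₃ ∈ ℤ_{≥1}
  have hnr : ∀ n : ℕ, 2 * etaEvent M a Λ ω m - (s : ℂ) +
      eulerGaugeα (mass₂ M a Λ ω m) (mass₃ M a Λ s ω m) - 1 ≠ -((n : ℂ) + 1) := by
    intro n
    unfold mass₂ mass₃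
    rw [rho_add_eta_sub_one_eq]
    exact nonres_of_pairCondition hp₃ n
  obtain ⟨u, hu, huv⟩ := kB z₂ _ _ _ _ _ _ _ _ v hz₂ hF hroot hρ hre hnr hv
  rw [euler_swap_α, euler_swap_β, euler_swap_γ, euler_swap_δ, euler_swap_ε, euler_swap_q] at hu
  -- gauge glue with the swapped masses (m₁, m₃, m₂, m₄)
  obtain ⟨Rt, hRt, hRtu⟩ := kG z₂ (mass₁ M a Λ s ω m) (mass₃ M a Λ s ω m) (mass₂ M a Λ ω m)
    (mass₄ M a Λ ω m) (bigE M a Λ s ω m lam) _ u hz₂ hu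
  -- exponents of (3.26)
  have he₁ : 2 * etaEvent M a Λ ω m - (s : ℂ) + eulerGaugeα (mass₂ M a Λ ω m) (mass₃ M a Λ s ω m)
        - 1 + eulerGaugeδ (mass₁ M a Λ s ω m) (mass₃ M a Λ s ω m) / 2 =
      1 / 2 + etaCauchy M a Λ ω m + etaEvent M a Λ ω m := by
    unfold mass₁ mass₂ mass₃
    rw [eulerGaugeα_eta, eulerGaugeδ_swap_eta]
    ring
  have he₂ : eulerGaugeε (mass₂ M a Λ ω m) (mass₄ M a Λ ω m) / 2 =
      1 / 2 - etaCauchy M a Λ ω m - etaCosmo M a Λ ω m := by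
    unfold mass₂ mass₄
    rw [eulerGaugeε_swap_eta]
    ring
  rw [he₁, he₂] at hRt
  -- the coefficient of (3.25) = (3.11) with m₂ ↔ m₃ on (1, z₂)
  have hsub' := hsub
  obtain ⟨hM, hΛ, h01, h12, -⟩ := hsub'
  have hr₀ : 0 ≤ rMinus M a Λ := rMinus_nonneg M a Λ
  have hcoef : ∀ z ∈ Ioo 1 z₂,
      sqcdCoeff (mass₁ M a Λ s ω m) (mass₃ M a Λ s ω m) (mass₂ M a Λ ω m) (mass₄ M a Λ ω m)
          (bigE M a Λ s ω m lam) (z₂ : ℂ) z = tildeCoeff M a Λ s ω m lam z := by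
    intro z hz
    obtain ⟨hz1, hzz⟩ := hz
    unfold tildeCoeff bigE mass₁ mass₂ mass₃ mass₄
    rw [hz₂def] at hzz ⊢
    unfold zTwo
    symm
    refine ctdcTilde_eq_sqcd_swap (s : ℂ) η₀ η₁ η₂ (ltBlock M a Λ s ω m lam) ?_ ?_ ?_ ?_ ?_ ?_ ?_
    · exact_mod_cast (sub_pos.mpr h01).ne'
    · have : 0 < rCosmo M a Λ + (rMinus M a Λ + rPlus M a Λ + rCosmo M a Λ) := by linarith
      exact_mod_cast this.ne'
    · have : 0 < rPlus M a Λ + rCosmo M a Λ := by linarith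
      exact_mod_cast this.ne'
    · have : (0 : ℝ) < z := by linarith
      exact_mod_cast this.ne'
    · exact sub_ne_zero.mpr (by exact_mod_cast (ne_of_gt hz1))
    · unfold zTwo at hzz
      exact sub_ne_zero.mpr (by exact_mod_cast (ne_of_gt hzz))
    · rw [hz₂def] at hz₂
      unfold zTwo at hz₂
      have : (0 : ℝ) < ctdcZ₂ (rMinus M a Λ) (rPlus M a Λ) (rCosmo M a Λ) := by linarith
      exact_mod_cast this.ne'
  have hRt' : NormalFormModeData z₂ (tildeCoeff M a Λ s ω m lam)
      (1 / 2 + etaCauchy M a Λ ω m + etaEvent M a Λ ω m)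
      (1 / 2 - etaCauchy M a Λ ω m - etaCosmo M a Λ ω m) Rt := hRt.congr hcoef
  -- energy identity on the swapped problem, then back through the injectivities
  have hRt0 := k2 M a Λ s ω m lam Rt hsub ha hω hlam hSR hRt'
  exact hvR (huv (hRtu hRt0))

/-- **Route W, full spin range, non-resonant variant.** With `SpinFlip` for `s ≥ 1`, the four
statements above imply the conclusion for every `s` with `2s ∈ ℤ` (the pair sum
`p₃ = −2(η₁ + η₀)` does not depend on `s`, so the same pair condition serves the spin-`−s`
companion). PROVED. -/
theorem radial_vanishing_of_routeW_nonres (kA : Transfer) (kB : EulerRLNonRes) (kG : GaugeGlue)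
    (k2 : SwappedEnergyVanishing) (kC : SpinFlip) {M a Λ s : ℝ} {ω : ℂ} {m : ℝ} {lam : ℂ}
    {R : ℝ → ℂ} (hsub : IsSubextremal M a Λ) (ha : 0 ≤ a) (h2s : ∃ k : ℤ, 2 * s = k)
    (hω : 0 < ω.im) (hlam : (lambdaBar a Λ s ω m lam * (starRingEnd ℂ) ω).im ≤ 0)
    (hSR : ¬(0 < ‖ω‖ ∧ ‖ω‖ < |m| * superradiantUpper M a Λ))
    (hp₃ : PairCondition (-2 * (etaEvent M a Λ ω m + etaCauchy M a Λ ω m)))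
    (hR : IsRadialTeukolskySolution M a Λ s ω m lam R) (hin : IsIngoingAtEventHorizon M a Λ s ω m R)
    (hout : IsOutgoingAtCosmoHorizon M a Λ ω m R) :
    ∀ r ∈ Ioo (rPlus M a Λ) (rCosmo M a Λ), R r = 0 := by
  by_cases hs : s < 1
  · exact radial_vanishing_of_routeW_nonres_lt_one kA kB kG k2 hsub ha hs hω hlam hSR hp₃ hR hin
      hout
  · have hs1 : 1 ≤ s := not_lt.mp hs
    obtain ⟨R', hR', hin', hout', hback⟩ := kC M a Λ s ω m lam R hsub hs1 h2s hω hR hin hout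
    have hs' : -s < 1 := by linarith
    have hlam' : (lambdaBar a Λ (-s) ω m (lamFlip a Λ s lam) * (starRingEnd ℂ) ω).im ≤ 0 := by
      rw [lambdaBar_lamFlip]; exact hlam
    exact hback (radial_vanishing_of_routeW_nonres_lt_one kA kB kG k2 hsub ha hs' hω hlam' hSR hp₃
      hR' hin' hout')

/-- **ROUTE W (NON-RESONANT VARIANT) REDUCES H3.** `Transfer`, `EulerRLNonRes`, `GaugeGlue`,
`SwappedEnergyVanishing` and `SpinFlip` imply the cell's cited fact
`CasalsTeixeiraDaCosta2022_partialModeStabilityProp38` VERBATIM. Of its Proposition-3.8 side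
conditions exactly one is used: the pair condition on `m₁ + m₃ = −2(η₁ + η₀)`, which is the
non-resonance of the hidden-symmetry transform; `Σ m_j ∉ ℤ_{≥2}` and the other three pair
conditions remain unused. PROVED; with `transfer_holds`, `gaugeGlue_holds`,
`swappedEnergyVanishing_holds` landed, the open hypotheses are `EulerRLNonRes` (all spins) and
`SpinFlip` (`s ≥ 1` only). -/
theorem prop38_of_routeW_nonres (kA : Transfer) (kB : EulerRLNonRes) (kG : GaugeGlue)
    (k2 : SwappedEnergyVanishing) (kC : SpinFlip) :
    CasalsTeixeiraDaCosta2022_partialModeStabilityProp38 := by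
  intro M a Λ s ω m lam hsub ha _ h2s _ hω hlam hSR _ _ _ hp₃ _ R hR hin hout
  exact radial_vanishing_of_routeW_nonres kA kB kG k2 kC hsub ha h2s hω hlam hSR hp₃ hR hin hout

end RouteW

end Summit.Ventures.KdS
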